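import Summits.AnomalousDissipation.AnomalousDissipation.Theorems.SolenoidalFractalHomogenisationLagrangianStepCellChainPair
import Summits.AnomalousDissipation.AnomalousDissipation.Theorems.SolenoidalFractalHomogenisationLagrangianStepW7EngineSpineAC
import HarnessLib

/-!
# K1L_D `LagrangianRenormalisationStepDesign` (stmt-AnomalousDissipation-27980), W7 engine sub-piece S1a: SPECTRAL-GAP lower bound of the dissipation
# density and the BARE exponential decay of the energy representative (regime (R1)/(R-c) `k̃ ≥ k̃_*` of the W7 engine)
# (helper; `--supports stmt-AnomalousDissipation-27980`)

Summits-side helper file of route `SolenoidalFractalHomogenisation` (prover seat `ad-k1l-cellLawV-w1` g4; planner ad-ideate-p4 g13 memo §4 (R1) / tenure 22:16:05Z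
(R-c)).  Everything proved; no definitions, no named facts, no sorry.  With `E, Q` from `…CellChainEnergy.exists_energyRep` (conjuncts passed as hypotheses):

* `gap_lower_bound` (fixed time) / **`ae_gap_lower_bound`** — if every mode the solution carries at time `t` has `|k|² ≥ ρ`, then
  `4π²·lo·ρ·E t ≤ Q t` (the `W = ∅` case of `block_split_le`);
* **`energy_le_exp_of_gap`** — consequently `E t ≤ exp(−8π²·lo·ρ·t)·E 0` on `[0,T]` (p5 g10's AC Grönwall `W7Engine.gronwall_ac_exp` with the constant rate):
  the ν-explicit bare decay used on the fibres with `k̃ ≥ k̃_*`, where no hypocoercivity functional is needed — for a class-pair-supported cell solution the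
  gap is `ρ = dist(ℓ, nℤ³)²` (`…CellChainClassPair`).
NOT a proof of any registered stub, of the crux, or of anomalous dissipation; rung F-D1.A0 infrastructure.
-/

set_option linter.dupNamespace false

noncomputable section

namespace Summit.AnomalousDissipation.AnomalousDissipation.Theorems.SolenoidalFractalHomogenisation.LagrangianStep.CellChain

open Set MeasureTheory Filter Topology Function Complex UnitAddTorus
open scoped InnerProductSpace ComplexConjugate
open Literature.Analysis Literature.Analysis.FunctionSpaces Literature.Analysis.FunctionSpaces.Torus
open Literature.Analysis.FluidPDE Literature.Analysis.FluidPDE.Torus Literature.Analysis.FluidPDE.LatticeShear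
open Summit.AnomalousDissipation.AnomalousDissipation.Theorems.SolenoidalFractalHomogenisation.RealisedQuasiStaticCellLaw
open Summit.AnomalousDissipation.AnomalousDissipation.Theorems.SolenoidalFractalHomogenisation.LagrangianStep.W7Engine

/-- **Spectral-gap lower bound of the dissipation density (fixed time)**: if every mode carried by `X` has `|k|² ≥ ρ`, then `4π²·lo·ρ·E ≤ q`.
[cite: Temam1984, Ch. III §1 Lemma 1.2 (energy inequality)] -/
theorem gap_lower_bound {X : (Fin 3 → ℤ) → EuclideanSpace ℂ (Fin 3)} {𝔸 : Torus.Visc4 (Fin 3)} {lo E q ρ : ℝ} (hlo : 0 ≤ lo) (hρ : 0 ≤ ρ)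
    (hpars : HasSum (fun k => ‖X k‖ ^ 2) E)
    (hblock : ∀ S : Finset (Fin 3 → ℤ), 4 * Real.pi ^ 2 * ∑ k ∈ S, (⟪X k, Torus.symbT 𝔸 k (X k)⟫_ℂ).re ≤ q)
    (hcoer : ∀ k, lo * (freqNormSq k * ‖X k‖ ^ 2) ≤ (⟪X k, Torus.symbT 𝔸 k (X k)⟫_ℂ).re)
    (hgap : ∀ k, X k ≠ 0 → ρ ≤ freqNormSq k) :
    4 * Real.pi ^ 2 * lo * ρ * E ≤ q := by
  have h := block_split_le (dmin := 8 * Real.pi ^ 2 * lo * ρ) (by positivity) hpars hblock hcoer ∅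
    (fun k _ hX => mul_le_mul_of_nonneg_left (hgap k hX) (by positivity))
  simp only [Finset.sum_empty, mul_zero, zero_add, sub_zero] at h
  linarith

/-- **Spectral-gap lower bound, a.e. along a weak solution**: with `E = ∫‖u t‖²` a.e. and the finite-block bounds of `Q` (conjuncts of `exists_energyRep`),
if for a.e. `t` every mode of `u t` has `|k|² ≥ ρ`, then `4π²·lo·ρ·E t ≤ Q t` for a.e. `t ∈ (0,T)`. [cite: Temam1984, Ch. III §1 Lemma 1.2 (energy inequality)] -/
theorem ae_gap_lower_bound {T : ℝ} {𝔹 : Torus.Visc4 (Fin 3)} {b u : ℝ → UnitAddTorus (Fin 3) → EuclideanSpace ℝ (Fin 3)}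
    {F : UnitAddTorus (Fin 3) → EuclideanSpace ℝ (Fin 3)} (h : Torus.IsWeakTensorPassiveVectorOn 0 T 𝔹 b F u) {lo hi : ℝ}
    (h𝔹 : Torus.NearIso 𝔹 lo hi) (hlo : 0 ≤ lo) {E Q : ℝ → ℝ}
    (hE : ∀ᵐ t ∂(volume.restrict (Ioo 0 T)), E t = ∫ x, ‖u t x‖ ^ 2)
    (hQ : ∀ᵐ t ∂(volume.restrict (Ioo 0 T)), ∀ S : Finset (Fin 3 → ℤ),
      4 * Real.pi ^ 2 * ∑ k ∈ S, (⟪mFourierCoeff (EuclideanSpace.complexify ∘ u t) k,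
        Torus.symbT 𝔹 k (mFourierCoeff (EuclideanSpace.complexify ∘ u t) k)⟫_ℂ).re ≤ Q t)
    {ρ : ℝ} (hρ : 0 ≤ ρ)
    (hgap : ∀ᵐ t ∂(volume.restrict (Ioo 0 T)), ∀ k, mFourierCoeff (EuclideanSpace.complexify ∘ u t) k ≠ 0 → ρ ≤ freqNormSq k) :
    ∀ᵐ t ∂(volume.restrict (Ioo 0 T)), 4 * Real.pi ^ 2 * lo * ρ * E t ≤ Q t := by
  have htr := ae_all_iff.2 fun k => h.ae_sum_mul_mFourierCoeff_eq_zero k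
  filter_upwards [hE, hQ, hgap, htr, h.ae_memLp_two] with t hEt hQt hgapt htrt h2
  have hpars : HasSum (fun k => ‖mFourierCoeff (EuclideanSpace.complexify ∘ u t) k‖ ^ 2) (E t) := by
    rw [hEt]; exact hasSum_sq_norm_mFourierCoeff_complexify h2
  exact gap_lower_bound hlo hρ hpars hQt (fun k => Torus.lo_mul_le_re_inner_symbT h𝔹 (htrt k)) hgapt

/-- **Bare exponential decay from a spectral gap**: if `E` is absolutely continuous on the subintervals of `[0,T]` with `E' = −2Q` a.e. and
`4π²·lo·ρ·E ≤ Q` a.e. on `(0,T)`, then `E t ≤ exp(−8π²·lo·ρ·t)·E 0` for every `t ∈ [0,T]`. [cite: Temam1984, Ch. III §1 Lemma 1.2 (energy inequality)] -/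
theorem energy_le_exp_of_gap {T : ℝ} {E Q : ℝ → ℝ} {lo ρ : ℝ}
    (hAC : ∀ a ∈ Icc 0 T, ∀ b' ∈ Icc 0 T, AbsolutelyContinuousOnInterval E a b')
    (hd : ∀ᵐ t ∂(volume : Measure ℝ), t ∈ Ioo 0 T → HasDerivAt E (-(2 * Q t)) t)
    (hlow : ∀ᵐ t ∂(volume.restrict (Ioo 0 T)), 4 * Real.pi ^ 2 * lo * ρ * E t ≤ Q t) {t : ℝ} (ht : t ∈ Icc 0 T) :
    E t ≤ Real.exp (-(8 * Real.pi ^ 2 * lo * ρ * t)) * E 0 := by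
  have hlow' : ∀ᵐ s ∂(volume : Measure ℝ), s ∈ Ioo 0 T → 4 * Real.pi ^ 2 * lo * ρ * E s ≤ Q s :=
    (ae_restrict_iff' measurableSet_Ioo).1 hlow
  have h0 : ∀ᵐ s ∂(volume : Measure ℝ), s ≠ (0:ℝ) := by
    have : ({(0:ℝ)}ᶜ : Set ℝ) ∈ ae (volume : Measure ℝ) := compl_mem_ae_iff.2 (measure_singleton _)
    filter_upwards [this] with s hs
    simpa using hs
  have hT' : ∀ᵐ s ∂(volume : Measure ℝ), s ≠ T := by
    have : ({T}ᶜ : Set ℝ) ∈ ae (volume : Measure ℝ) := compl_mem_ae_iff.2 (measure_singleton _)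
    filter_upwards [this] with s hs
    simpa using hs
  have hmem : ∀ s, s ∈ uIcc 0 t → s ≠ 0 → s ≠ T → s ∈ Ioo 0 T := by
    intro s hs hs0 hsT
    rw [uIcc_of_le ht.1] at hs
    exact ⟨lt_of_le_of_ne hs.1 (Ne.symm hs0), lt_of_le_of_ne (hs.2.trans ht.2) hsT⟩
  have hderiv : ∀ᵐ s ∂(volume : Measure ℝ), s ∈ uIcc 0 t → HasDerivAt E (-(2 * Q s)) s := by
    filter_upwards [hd, h0, hT'] with s hs hs0 hsT hsI
    exact hs (hmem s hsI hs0 hsT)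
  have hineq : ∀ᵐ s ∂(volume : Measure ℝ), s ∈ uIcc 0 t → -(2 * Q s) ≤ -(8 * Real.pi ^ 2 * lo * ρ) * E s := by
    filter_upwards [hlow', h0, hT'] with s hs hs0 hsT hsI
    have := hs (hmem s hsI hs0 hsT)
    linarith
  have hg := gronwall_ac_exp (σ := fun _ => 8 * Real.pi ^ 2 * lo * ρ) ht.1 (hAC 0 ⟨le_rfl, ht.1.trans ht.2⟩ t ht) hderiv
    continuous_const hineq
  rw [intervalIntegral.integral_const, smul_eq_mul, sub_zero] at hg
  calc E t ≤ Real.exp (-(t * (8 * Real.pi ^ 2 * lo * ρ))) * E 0 := hg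
    _ = Real.exp (-(8 * Real.pi ^ 2 * lo * ρ * t)) * E 0 := by ring_nf

end Summit.AnomalousDissipation.AnomalousDissipation.Theorems.SolenoidalFractalHomogenisation.LagrangianStep.CellChain

end
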